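import Summits.ResolutionOfSingularities.KangarooAtlas.MizutaniSpreadOps
import Summits.ResolutionOfSingularities.KangarooAtlas.MizutaniDigitLemma
import Mathlib.Algebra.CharP.Defs
import HarnessLib

/-!
# Mizutani's conjecture `m(e) = 2p^e − 1` — SPREADING, II: truncation to the box and the profile inequality

Cell topic `Summits/ResolutionOfSingularities/KangarooAtlas` (pub-rosobs); namespace
`Summit.ResolutionOfSingularities.KangarooAtlas.Mizutani`.  Part of the Lean transcription of the
in-house note MIZUTANI-PROOF-g59 (AI-written, AI-audited; *AI review is weaker than expert review*; not a
resolution theorem).  Encloser-1 ARCH-e1 (S2), second half: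

* `trunc q` — the `k`-linear truncation to the box `[0,q−1]^ι` (the relations `t_i^q = 0` of
  `k ⊗_L k = k[t]/(t^q)`), `coeff_trunc`;
* `trunc_opE` — in characteristic `p` with `q = p^e`, truncation commutes with `E_T` for `T` in the box:
  a monomial `X^M` outside the box only produces monomials outside the box, because `C(M,T₂) ≠ 0 (mod p)`
  forces `T₂ ≤_d M` digitwise (Lucas) and the subtraction `M − T₂` keeps the high digits
  (`pow_le_sub_of_not_dvd_choose`);
* **`eProfile_trunc_theta_le`** — `σ^{D'}_r (trunc (θ f)) ≤ σ^D_r (f)` for `r + 1 ≤ q`: the profile of the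
  spread-and-truncated element (computed with the recombined operators) is dominated by the profile of `f`
  (MIZUTANI-PROOF-g59 §1.4 INVARIANCES / §5: `σ(A·ω) = σ(ω)`; only this inequality is used).

References: [Mizutani1973HironakaGroupSchemes] (Remark 2.10; in-house proof §1.4, §5); Lucas via Mathlib and
the cell's `MizutaniDigitLemma`.
-/

open MvPolynomial Literature.AlgebraicGeometry.Resolution

namespace Summit.ResolutionOfSingularities.KangarooAtlas.Mizutani

/-! ## Lucas: subtracting a digitwise-dominated number keeps the high digits -/

section Lucas

variable {p : ℕ} [hp : Fact p.Prime]

omit hp in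
/-- Low digits of `m mod p^e` are those of `m`. [folklore] -/
theorem digit_mod_pow {m e l : ℕ} (hl : l < e) :
    DigitLemma.digit p (m % p ^ e) l = DigitLemma.digit p m l := by
  unfold DigitLemma.digit
  have hsplit : p ^ e = p ^ l * p ^ (e - l) := by rw [← pow_add]; congr 1; omega
  rw [hsplit, Nat.mod_mul_right_div_self, Nat.mod_mod_of_dvd]
  exact dvd_pow_self p (by omega)

/-- **No borrow in the high digits**: if `p ∤ C(m,t)` (i.e. `t ≤_d m`), `t < p^e ≤ m`, then
`p^e ≤ m − t`. [folklore] -/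
theorem pow_le_sub_of_not_dvd_choose {m t e : ℕ} (h : ¬ p ∣ m.choose t) (ht : t < p ^ e)
    (hm : p ^ e ≤ m) : p ^ e ≤ m - t := by
  have hp2 : 2 ≤ p := hp.out.two_le
  have hd : DigitLemma.DigitLE p t m := (DigitLemma.digitLE_iff_not_dvd_choose t m).mpr h
  -- `t ≤_d (m mod p^e)`, hence `t ≤ m mod p^e`
  have hd' : DigitLemma.DigitLE p t (m % p ^ e) := by
    intro l
    by_cases hl : l < e
    · rw [digit_mod_pow hl]; exact hd l
    · push Not at hl
      rw [DigitLemma.digit_eq_zero_of_le hp2 ht hl]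
      exact Nat.zero_le _
  have hle : t ≤ m % p ^ e := DigitLemma.le_of_digitLE hp2 hd'
  have hdm := Nat.div_add_mod m (p ^ e)
  have hdiv : 1 ≤ m / p ^ e := (Nat.one_le_div_iff (by positivity)).mpr hm
  have hmul : p ^ e * 1 ≤ p ^ e * (m / p ^ e) := Nat.mul_le_mul_left _ hdiv
  rw [mul_one] at hmul
  omega

omit hp in
/-- A non-vanishing multi-binomial in characteristic `p` has no factor divisible by `p`. [folklore] -/
theorem not_dvd_choose_of_mchoose_cast_ne_zero {ι : Type*} (k : Type*) [CommRing k] [CharP k p]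
    {M T : ι →₀ ℕ} (h : (mchoose M T : k) ≠ 0) (l : ι) (hl : l ∈ T.support) :
    ¬ p ∣ (M l).choose (T l) := by
  classical
  intro hdvd
  apply h
  unfold mchoose
  rw [← Finset.mul_prod_erase _ _ hl, Nat.cast_mul, (CharP.cast_eq_zero_iff k p _).mpr hdvd, zero_mul]

/-- **Outside the box stays outside the box** (prime characteristic, `q = p^e`): if `X^M` is not in the box,
`T₂` is, and `C(M,T₂) ≠ 0` in `k`, then `X^{M−T₂}` is not in the box. [folklore] -/
theorem not_inBox_tsub {ι : Type*} (k : Type*) [CommRing k] [CharP k p] {e : ℕ} {M T₂ : ι →₀ ℕ}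
    (hM : ¬ InBox (p ^ e) M) (hT₂ : InBox (p ^ e) T₂) (h : (mchoose M T₂ : k) ≠ 0) :
    ¬ InBox (p ^ e) (M - T₂) := by
  intro hbox
  apply hM
  intro l
  by_contra hl
  push Not at hl
  have hsub := hbox l
  rw [Finsupp.tsub_apply] at hsub
  by_cases hlT : l ∈ T₂.support
  · exact absurd hsub (not_lt.mpr (pow_le_sub_of_not_dvd_choose
      (not_dvd_choose_of_mchoose_cast_ne_zero k h l hlT) (hT₂ l) hl))
  · rw [Finsupp.notMem_support_iff.mp hlT, Nat.sub_zero] at hsub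
    omega

end Lucas

/-! ## Truncation to the box -/

section Trunc

variable {ι : Type*} [Fintype ι] [DecidableEq ι] {k : Type*} [CommRing k]

/-- Decidability of the box predicate (finitely many coordinates). [folklore] -/
instance decidableInBox (q : ℕ) (M : ι →₀ ℕ) : Decidable (InBox q M) := by
  unfold InBox; infer_instance

/-- The summand of the truncation as an additive map of the coefficient. [folklore] -/
noncomputable def truncTerm (q : ℕ) (M : ι →₀ ℕ) : k →+ MvPolynomial ι k where
  toFun κ := if InBox q M then monomial M κ else 0
  map_zero' := by split_ifs <;> simp
  map_add' a b := by split_ifs <;> simp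

/-- **Truncation to the box** `[0,q−1]^ι` (the relations `t_i^q = 0` of `k ⊗_L k`), a `k`-linear map.
[cite: Oda1983HironakaGroupSchemeII, §1 (p. 1166: the (δa)^λ, λ in the box, are a basis)] -/
noncomputable def trunc (q : ℕ) : MvPolynomial ι k →ₗ[k] MvPolynomial ι k where
  toFun f := ∑ M ∈ f.support, truncTerm q M (coeff M f)
  map_add' f g := by
    rw [sum_support_subset (truncTerm q) (f + g) (support_add (p := f) (q := g)),
      sum_support_subset (truncTerm q) f (Finset.subset_union_left (s₂ := g.support)),
      sum_support_subset (truncTerm q) g (Finset.subset_union_right (s₁ := f.support)),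
      ← Finset.sum_add_distrib]
    exact Finset.sum_congr rfl fun M _ => by rw [coeff_add, map_add]
  map_smul' a f := by
    rw [sum_support_subset (truncTerm q) (a • f) (support_smul (f := f) (a := a)),
      RingHom.id_apply, Finset.smul_sum]
    refine Finset.sum_congr rfl fun M _ => ?_
    rw [coeff_smul]
    show (if InBox q M then _ else _) = a • (if InBox q M then _ else _)
    split_ifs <;> simp [smul_monomial]

/-- Truncation of a monomial. [folklore] -/
theorem trunc_monomial (q : ℕ) (M : ι →₀ ℕ) (κ : k) :
    trunc q (monomial M κ) = if InBox q M then monomial M κ else 0 := by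
  show ∑ M' ∈ (monomial M κ).support, truncTerm q M' (coeff M' (monomial M κ)) = _
  rw [sum_support_subset (truncTerm q) _ (support_monomial_subset (s := M) (a := κ)),
    Finset.sum_singleton, coeff_monomial, if_pos rfl]
  rfl

/-- **Coefficients of the truncation.** [folklore] -/
theorem coeff_trunc (q : ℕ) (f : MvPolynomial ι k) (N : ι →₀ ℕ) :
    coeff N (trunc q f) = if InBox q N then coeff N f else 0 := by
  induction f using MvPolynomial.induction_on' with
  | monomial M κ =>
    rw [trunc_monomial]
    by_cases hMN : M = N
    · subst hMN
      by_cases hM : InBox q M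
      · rw [if_pos hM, if_pos hM]
      · rw [if_neg hM, if_neg hM, coeff_zero]
    · have h1 : coeff N (monomial M κ) = 0 := by rw [coeff_monomial, if_neg hMN]
      rw [h1]
      by_cases hM : InBox q M
      · rw [if_pos hM, h1]; split_ifs <;> rfl
      · rw [if_neg hM, coeff_zero]; split_ifs <;> rfl
  | add f g hf hg =>
    rw [map_add, coeff_add, coeff_add, hf, hg]
    split_ifs <;> ring

/-- The truncation is supported in the box. [folklore] -/
theorem inBox_of_mem_support_trunc (q : ℕ) (f : MvPolynomial ι k) {N : ι →₀ ℕ}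
    (hN : N ∈ (trunc q f).support) : InBox q N := by
  by_contra h
  rw [mem_support_iff, coeff_trunc, if_neg h] at hN
  exact hN rfl

/-- A box-supported polynomial is its own truncation. [folklore] -/
theorem trunc_eq_self {q : ℕ} {f : MvPolynomial ι k} (hf : ∀ M ∈ f.support, InBox q M) :
    trunc q f = f := by
  refine MvPolynomial.ext _ _ fun N => ?_
  rw [coeff_trunc]
  split_ifs with h
  · rfl
  · by_contra hne
    exact h (hf N (mem_support_iff.mpr (Ne.symm hne)))

/-- **Truncation commutes with `E_T` for `T` in the box** (prime characteristic, `q = p^e`).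
[cite: Oda1983HironakaGroupSchemeII, §1 (p. 1166; the D^{(T)} ⊗ 1 act on k ⊗_L k = k[t]/(t^q))] -/
theorem trunc_opE {p e : ℕ} [Fact p.Prime] [CharP k p] (D : (ι →₀ ℕ) → k →+ k) {T : ι →₀ ℕ}
    (hT : InBox (p ^ e) T) (g : MvPolynomial ι k) :
    trunc (p ^ e) (opE D T g) = opE D T (trunc (p ^ e) g) := by
  induction g using MvPolynomial.induction_on' with
  | monomial M κ =>
    rw [opE_monomial, map_sum, trunc_monomial]
    by_cases hM : InBox (p ^ e) M
    · rw [if_pos hM, opE_monomial]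
      refine Finset.sum_congr rfl fun x _ => ?_
      rw [trunc_monomial, if_pos]
      intro l
      rw [Finsupp.tsub_apply]
      exact lt_of_le_of_lt (Nat.sub_le _ _) (hM l)
    · rw [if_neg hM, opE_zero_right]
      refine Finset.sum_eq_zero fun x hx => ?_
      rw [trunc_monomial]
      split_ifs with hbox
      · -- then the binomial vanishes
        have hx' : x.1 + x.2 = T := Finset.HasAntidiagonal.mem_antidiagonal.mp hx
        have hT₂ : InBox (p ^ e) x.2 := fun l => by
          have : x.2 l ≤ T l := by rw [← hx']; exact Nat.le_add_left _ _
          exact lt_of_le_of_lt this (hT l)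
        by_cases hmc : (mchoose M x.2 : k) = 0
        · rw [hmc, zero_mul, monomial_zero]
        · exact absurd hbox (not_inBox_tsub k hM hT₂ hmc)
      · rfl
  | add f g hf hg => rw [opE_add, map_add, map_add, opE_add, hf, hg]

end Trunc

/-! ## The profile inequality for spreading -/

section Profile

variable {ι : Type*} [Fintype ι] [DecidableEq ι] {k : Type*} [Field k] {p e : ℕ} [Fact p.Prime] [CharP k p]

/-- **SPREADING DOES NOT RAISE THE PROFILE** (encloser-1 ARCH-e1 (S2); MIZUTANI-PROOF-g59 §1.4/§5
"`σ(A·ω) = σ(ω)`", the inequality actually used): for `r + 1 ≤ q = p^e`,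
`σ^{D'}_r (trunc (θ f)) ≤ σ^D_r (f)` where `D'` is the recombined family and the operators commute with a
subring of scalars containing `β`.
[cite: Mizutani1973HironakaGroupSchemes, Remark 2.10 (in-house proof §5, Thm D″ / profile invariance)] -/
theorem eProfile_trunc_theta_le (j i : ι) {β : k} (L : Subring k) (hβ : β ∈ L)
    (D : (ι →₀ ℕ) → k →+ k) (hDL : ∀ c ∈ L, ∀ T x, D T (c * x) = c * D T x) {r : ℕ}
    (hr : r + 1 ≤ p ^ e) (f : MvPolynomial ι k) :
    eProfile (recombD j i β D) r (trunc (p ^ e) (theta j i β f)) ≤ eProfile D r f := by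
  have hle : eSpan (recombD j i β D) r (trunc (p ^ e) (theta j i β f)) ≤
      (eSpan D r f).map ((trunc (p ^ e)).comp (theta j i β).toLinearMap) := by
    unfold eSpan
    rw [Submodule.span_le]
    rintro g ⟨T, hT, rfl⟩
    have hTdeg : T.degree ≤ r := mem_degLE.mp (Finset.mem_coe.mp hT)
    have hTbox : InBox (p ^ e) T := fun l => by
      have := Finsupp.le_degree l T
      omega
    show opE (recombD j i β D) T (trunc (p ^ e) (theta j i β f)) ∈ _
    rw [← trunc_opE (recombD j i β D) hTbox, opE_theta j i L hβ D hDL, map_sum]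
    refine Submodule.sum_mem _ fun T₁ hT₁ => ?_
    rw [C_mul', LinearMap.map_smul]
    refine Submodule.smul_mem _ _ (Submodule.mem_map_of_mem ?_)
    exact Submodule.subset_span ⟨T₁, Finset.mem_coe.mpr (mem_degLE.mpr ((mem_degLE.mp hT₁).trans hTdeg)), rfl⟩
  unfold eProfile
  haveI := eSpan_finite D r f
  exact (Submodule.finrank_mono hle).trans (Submodule.finrank_map_le _ _)

end Profile

end Summit.ResolutionOfSingularities.KangarooAtlas.Mizutani
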